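import Mathlib
import HarnessLib
import Literature.Analysis.FluidPDE.VorticityCalculus
import Literature.Analysis.FluidPDE.AncientSimilarityVorticity
import Literature.Analysis.FluidPDE.DivFreeVectorPotential
import Summits.NavierStokesRegularity.NavierStokesRegularity.Theorems.UnthreadedRigidityDoorUnthreadedRigidityVirialHornAnalyticWedge
import Summits.NavierStokesRegularity.NavierStokesRegularity.Theorems.UnthreadedRigidityDoorUnthreadedRigidityVirialHornAngularJets

/-!
# Route `UnthreadedRigidityDoor`, item `UnthreadedRigidity` (W2, stmt-NavierStokesRegularity-27585) — LINE g11-1 «VIRIAL HORN»: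
# SHELL CALCULUS — the radial velocity of a poloidal shell is `l(l+1)` times its stream function

Kernel identities for the poloidal data of the line (`sepShellL`, `isoShellL` of the Defs twin p695782):

* §1 small vector calculus on `ℝ³` in the tree's vocabulary (`curl`, `cross`, `curlCLM`, `VectorCalculus.divergence`):
  `curl (ψ y · y) = ∇ψ × y` (`curl_smul_self`), `⟪curl(W × y)(x), x⟫ = ⟪DW(x)x, x⟫ + 2⟪W, x⟫ − div W |x|²` (`inner_curl_cross_self`);
* §2 solid harmonics (`IsSolidHarmonic l Y`: a homogeneous harmonic polynomial of degree `l`): the scaling law `Y(s y) = s^l Y(y)`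
  (`IsSolidHarmonic.apply_smul`), Euler's identities `∇Y·y = lY`, `⟪D∇Y(y)y, y⟫ = l(l−1)Y` and `div ∇Y = 0`;
* §3 ONE SHELL: `curl (h(|y|²)Y(y) y) = h(|y|²) ∇Y × y` (`curl_shell_eq`) and the RADIAL IDENTITY
  `⟪curl curl (h(|y|²) Y(y) y), y⟫ = l(l+1) h(|y|²) Y(y)` (`inner_curl_curl_shell_self`; `h ∈ C¹`, `l ≥ 1`) — the radial profile
  factors out because `∇h(|y|²) ∥ y`, and the polynomial identity `⟪curl(∇Y × y), y⟫ = l(l+1)Y` is Euler twice plus `ΔY = 0`;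
* §4 ISOTYPIC SUMS: `⟪isoShellL n c B x₀ (x₀ + y), y⟫ = l(l+1) Σ_m c_m(|y|) B_m(y)` (`inner_isoShellL_self`) for admissible families
  (`IsoAdmissibleL`), i.e. the stream function of an isotypic slice is read off its radial velocity.

Used by `…VirialHornWindowCoeffAnalytic.lean` (analyticity of the coefficient profiles = the analytic-profile conjunct of BRIDGE W).
HONEST LABEL: elementary calculus of special poloidal data for one RUNG line; `UnthreadedRigidity` (27585), W2 and NS regularity
remain OPEN; nothing here is a statement about Navier–Stokes solutions.  `--supports stmt-NavierStokesRegularity-27585` (helper);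
ns-crc-p2 g8.  [cite: MajdaBertozziCUP2002, §1.1 (vector identities)]
-/

-- the summit and its single sub-problem share the name (CONVENTIONS §1)
set_option linter.dupNamespace false

namespace Summit.NavierStokesRegularity.NavierStokesRegularity.Theorems.UnthreadedRigidity.VirialHorn

open scoped Topology
open Filter Set Function
open Summit.NavierStokesRegularity.NavierStokesRegularity.Theorems.UnthreadedRigidity.ProfileHorn (E3)
open Literature.Analysis.FluidPDE

/-! ## §1 Small vector-calculus facts on `ℝ³` -/

/-- `⟪a × b, a⟫ = 0`. [folklore] -/
theorem inner_cross_self_left (a b : E3) : inner ℝ (cross a b) a = 0 := by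
  simp only [cross, PiLp.inner_apply, RCLike.inner_apply, conj_trivial, Fin.sum_univ_three,
    cross_apply, Matrix.cons_val_zero, Matrix.cons_val_one, Matrix.cons_val_two,
    Matrix.head_cons, Matrix.tail_cons]
  ring

/-- `innerSL ℝ z` is the Riesz dual of `z`. [folklore] -/
theorem toDual_symm_innerSL (z : E3) : (InnerProductSpace.toDual ℝ E3).symm (innerSL ℝ z) = z := by
  apply (InnerProductSpace.toDual ℝ E3).injective
  rw [LinearIsometryEquiv.apply_symm_apply]
  ext y
  simp [InnerProductSpace.toDual_apply_apply]

/-- CURL OF A RADIAL MULTIPLE OF THE POSITION FIELD: `curl (ψ y · y) = ∇ψ × y`. [folklore] -/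
theorem curl_smul_self {ψ : E3 → ℝ} {x : E3} (hψ : DifferentiableAt ℝ ψ x) :
    curl (fun y : E3 => ψ y • y) x = cross (gradient ψ x) x := by
  have hid : DifferentiableAt ℝ (fun y : E3 => y) x := differentiableAt_id
  have hcid : curl (fun y : E3 => y) x = 0 := by
    have h : fderiv ℝ (fun y : E3 => y) x = ContinuousLinearMap.id ℝ E3 := fderiv_id
    rw [curl_eq_curlCLM, h]
    simp [curlCLM_apply]
  rw [curl_smul hψ hid, hcid, smul_zero, zero_add, curlCLM_smulRight]
  rfl

/-- RADIAL COMPONENT OF `curl (W × y)`: `⟪curl(W × y)(x), x⟫ = ⟪DW(x)x, x⟫ + 2⟪W x, x⟫ − div W(x) |x|²`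
(`curl (W × Ω) = DW[Ω] − (div W)Ω + (div Ω)W − DΩ[W]` with `Ω = id`, `div id = 3`). [cite: MajdaBertozziCUP2002, §1.1 (vector identities)] -/
theorem inner_curl_cross_self {W : E3 → E3} {x : E3} (hW : DifferentiableAt ℝ W x) :
    inner ℝ (curl (fun y : E3 => cross (W y) y) x) x =
      inner ℝ (fderiv ℝ W x x) x + 2 * inner ℝ (W x) x - VectorCalculus.divergence W x * ‖x‖ ^ 2 := by
  have hid : DifferentiableAt ℝ (fun y : E3 => y) x := differentiableAt_id
  have h : fderiv ℝ (fun y : E3 => y) x = ContinuousLinearMap.id ℝ E3 := fderiv_id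
  have hdiv : VectorCalculus.divergence (fun y : E3 => y) x = 3 := by
    rw [VectorCalculus.divergence, h]
    simp [LinearMap.trace_id, finrank_euclideanSpace]
  rw [curl_cross_apply hW hid, hdiv]
  rw [h, ContinuousLinearMap.id_apply, inner_sub_left, inner_add_left, inner_sub_left, inner_smul_left,
    inner_smul_left, real_inner_self_eq_norm_sq]
  simp only [conj_trivial]
  ring

/-! ## §2 Solid harmonics: scaling, Euler identities, `div ∇Y = 0` -/

/-- EULER'S IDENTITY from a scaling law: `F(s y) = s^k F(y)` for `s > 0` and `F` differentiable at `y` give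
`DF(y)·y = k F(y)`. [folklore] -/
theorem fderiv_apply_self_of_scaling {F : E3 → ℝ} {k : ℕ} {y : E3}
    (hF : ∀ s : ℝ, 0 < s → ∀ z : E3, F (s • z) = s ^ k * F z) (hd : DifferentiableAt ℝ F y) :
    fderiv ℝ F y y = k * F y := by
  -- differentiate `s ↦ F(s y) = s^k F(y)` at `s = 1`
  have h1 : HasDerivAt (fun s : ℝ => F (s • y)) (fderiv ℝ F ((1 : ℝ) • y) y) 1 := by
    have hs : HasDerivAt (fun s : ℝ => s • y) y (1 : ℝ) := by
      simpa using (hasDerivAt_id (1 : ℝ)).smul_const y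
    have hd' : DifferentiableAt ℝ F ((1 : ℝ) • y) := by rwa [one_smul]
    exact hd'.hasFDerivAt.comp_hasDerivAt (1 : ℝ) hs
  rw [one_smul] at h1
  have h2 : HasDerivAt (fun s : ℝ => s ^ k * F y) ((k : ℝ) * (1 : ℝ) ^ (k - 1) * F y) 1 :=
    (hasDerivAt_pow k (1 : ℝ)).mul_const (F y)
  rw [one_pow, mul_one] at h2
  have heq : (fun s : ℝ => F (s • y)) =ᶠ[𝓝 (1 : ℝ)] fun s : ℝ => s ^ k * F y := by
    filter_upwards [Ioi_mem_nhds (zero_lt_one' ℝ)] with s hs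
    exact hF s hs y
  exact (h1.congr_of_eventuallyEq heq.symm).unique h2

/-- EULER for a solid harmonic: `∇Y(y)·y = l Y(y)`. [folklore] -/
theorem IsSolidHarmonic.fderiv_apply_self {l : ℕ} {Y : E3 → ℝ} (hY : IsSolidHarmonic l Y) (y : E3) :
    fderiv ℝ Y y y = l * Y y :=
  fderiv_apply_self_of_scaling (fun s _ z => hY.apply_smul s z)
    ((hY.contDiff.differentiable (by simp)).differentiableAt)

/-- The directional derivative `z ↦ DY(z)·v` of a solid harmonic of degree `l ≥ 1` scales with degree `l − 1`:
`DY(s z)·v = s^{l−1} DY(z)·v` (`s > 0`). [folklore] -/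
theorem IsSolidHarmonic.fderiv_apply_smul {l : ℕ} {Y : E3 → ℝ} (hY : IsSolidHarmonic l Y) (hl : 1 ≤ l)
    {s : ℝ} (hs : 0 < s) (z v : E3) :
    fderiv ℝ Y (s • z) v = s ^ (l - 1) * fderiv ℝ Y z v := by
  have hdiff : Differentiable ℝ Y := hY.contDiff.differentiable (by simp)
  -- `Y ∘ (s • ·) = s^l • Y`, differentiate at `z` in the direction `v`
  have hcomp : fderiv ℝ (fun w : E3 => Y (s • w)) z v = fderiv ℝ Y (s • z) (s • v) := by
    have hsm : HasFDerivAt (fun w : E3 => s • w) (s • ContinuousLinearMap.id ℝ E3) z :=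
      (s • ContinuousLinearMap.id ℝ E3).hasFDerivAt
    have hc := (hdiff (s • z)).hasFDerivAt.comp z hsm
    rw [show (fun w : E3 => Y (s • w)) = Y ∘ (fun w : E3 => s • w) from rfl, hc.fderiv]
    simp
  have hscal : fderiv ℝ (fun w : E3 => Y (s • w)) z v = s ^ l * fderiv ℝ Y z v := by
    have e : (fun w : E3 => Y (s • w)) = fun w => s ^ l * Y w := funext fun w => hY.apply_smul s w
    rw [e, fderiv_const_mul (hdiff z)]
    simp
  rw [hcomp, map_smul, smul_eq_mul] at hscal
  -- `s * DY(sz)v = s^l DY(z) v`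
  have hs0 : s ≠ 0 := hs.ne'
  have hl' : s ^ l = s * s ^ (l - 1) := by
    rw [← pow_succ']
    congr 1
    omega
  rw [hl', mul_assoc] at hscal
  exact mul_left_cancel₀ hs0 hscal

/-- SECOND EULER IDENTITY for a solid harmonic: `⟪D(∇Y)(y) y, y⟫ = l(l−1) Y(y)`. [folklore] -/
theorem IsSolidHarmonic.inner_fderiv_gradient_self {l : ℕ} {Y : E3 → ℝ} (hY : IsSolidHarmonic l Y) (hl : 1 ≤ l)
    (y : E3) :
    inner ℝ (fderiv ℝ (gradient Y) y y) y = (l : ℝ) * ((l : ℝ) - 1) * Y y := by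
  have hC2 : ContDiff ℝ 2 Y := hY.contDiff.of_le (by norm_cast)
  have hdiff : Differentiable ℝ Y := hY.contDiff.differentiable (by simp)
  have hgd : DifferentiableAt ℝ (gradient Y) y := by
    have h1 : ContDiff ℝ 1 (fderiv ℝ Y) := hC2.fderiv_right (m := 1) (by norm_cast)
    have h2 : DifferentiableAt ℝ (fderiv ℝ Y) y := (h1.differentiable (by simp)).differentiableAt
    exact ((InnerProductSpace.toDual ℝ E3).symm.differentiable.differentiableAt).comp y h2
  -- `⟪D(∇Y)(y) y, y⟫ = D(z ↦ DY(z)·y)(y)·y`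
  set g : E3 → ℝ := fun z => fderiv ℝ Y z y with hg
  have hg_eq : ∀ z, g z = inner ℝ (gradient Y z) y := fun z => by
    rw [hg, gradient, InnerProductSpace.toDual_symm_apply]
  have hinner : inner ℝ (fderiv ℝ (gradient Y) y y) y = fderiv ℝ g y y := by
    have hG : HasFDerivAt (fun z => inner ℝ (gradient Y z) y)
        ((fderivInnerCLM ℝ (gradient Y y, y)).comp ((fderiv ℝ (gradient Y) y).prod 0)) y :=
      hgd.hasFDerivAt.inner ℝ (hasFDerivAt_const y y)
    have e : g = fun z => inner ℝ (gradient Y z) y := funext hg_eq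
    rw [e, hG.fderiv]
    simp [fderivInnerCLM_apply, real_inner_comm]
  rw [hinner]
  -- `g` is homogeneous of degree `l − 1`
  have hghom : ∀ s : ℝ, 0 < s → ∀ z : E3, g (s • z) = s ^ (l - 1) * g z :=
    fun s hs z => hY.fderiv_apply_smul hl hs z y
  have hgdiff : DifferentiableAt ℝ g y := by
    have h1 : ContDiff ℝ 1 (fderiv ℝ Y) := hC2.fderiv_right (m := 1) (by norm_cast)
    have h2 : DifferentiableAt ℝ (fderiv ℝ Y) y := (h1.differentiable (by simp)).differentiableAt
    exact (ContinuousLinearMap.apply ℝ ℝ y).differentiableAt.comp y h2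
  rw [fderiv_apply_self_of_scaling hghom hgdiff]
  have hgy : g y = l * Y y := hY.fderiv_apply_self y
  have hcast : ((l - 1 : ℕ) : ℝ) = (l : ℝ) - 1 := by
    rw [Nat.cast_sub hl, Nat.cast_one]
  rw [hgy, hcast]
  ring

/-- `div ∇Y = ΔY = 0` for a solid harmonic (the tree's `lap3` is the trace of the Hessian). [folklore] -/
theorem IsSolidHarmonic.divergence_gradient {l : ℕ} {Y : E3 → ℝ} (hY : IsSolidHarmonic l Y) (y : E3) :
    VectorCalculus.divergence (gradient Y) y = 0 := by
  have hC2 : ContDiff ℝ 2 Y := hY.contDiff.of_le (by norm_cast)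
  have h1 : ContDiff ℝ 1 (fderiv ℝ Y) := hC2.fderiv_right (m := 1) (by norm_cast)
  have h2 : DifferentiableAt ℝ (fderiv ℝ Y) y := (h1.differentiable (by simp)).differentiableAt
  have hgd : DifferentiableAt ℝ (gradient Y) y :=
    ((InnerProductSpace.toDual ℝ E3).symm.differentiable.differentiableAt).comp y h2
  have hlap : lap3 Y y = 0 := hY.2 y
  rw [divergence_eq_sum_inner_fderiv (EuclideanSpace.basisFun (Fin 3) ℝ)]
  have hterm : ∀ i : Fin 3,
      inner ℝ ((EuclideanSpace.basisFun (Fin 3) ℝ) i) (fderiv ℝ (gradient Y) y ((EuclideanSpace.basisFun (Fin 3) ℝ) i)) =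
        dir2 Y (e i) y := by
    intro i
    have hb : (EuclideanSpace.basisFun (Fin 3) ℝ) i = e i := by simp [e]
    rw [hb]
    -- `dir2 Y b y = D(z ↦ ⟪∇Y z, b⟫)(y) b = ⟪D(∇Y)(y) b, b⟫`
    have hfun : (fun z => fderiv ℝ Y z (e i)) = fun z => inner ℝ (gradient Y z) (e i) := by
      funext z
      rw [gradient, InnerProductSpace.toDual_symm_apply]
    have hG : HasFDerivAt (fun z => inner ℝ (gradient Y z) (e i))
        ((fderivInnerCLM ℝ (gradient Y y, e i)).comp ((fderiv ℝ (gradient Y) y).prod 0)) y :=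
      hgd.hasFDerivAt.inner ℝ (hasFDerivAt_const (e i) y)
    rw [dir2, hfun, hG.fderiv]
    simp [fderivInnerCLM_apply, real_inner_comm]
  simp_rw [hterm]
  simpa [lap3] using hlap


/-! ## §3 The radial identity for a single shell -/

/-- The POLYNOMIAL RADIAL IDENTITY: `⟪curl(∇Y × y)(y), y⟫ = l(l+1) Y(y)` for a solid harmonic of degree `l ≥ 1`
(`= ⟪D∇Y(y)y, y⟫ + 2⟪∇Y(y), y⟫ − |y|² ΔY = l(l−1)Y + 2lY`). [folklore] -/
theorem IsSolidHarmonic.inner_curl_cross_gradient_self {l : ℕ} {Y : E3 → ℝ} (hY : IsSolidHarmonic l Y)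
    (hl : 1 ≤ l) (y : E3) :
    inner ℝ (curl (fun z : E3 => cross (gradient Y z) z) y) y = ((l : ℝ) * ((l : ℝ) + 1)) * Y y := by
  have hC2 : ContDiff ℝ 2 Y := hY.contDiff.of_le (by norm_cast)
  have h1 : ContDiff ℝ 1 (fderiv ℝ Y) := hC2.fderiv_right (m := 1) (by norm_cast)
  have hgd : DifferentiableAt ℝ (gradient Y) y :=
    ((InnerProductSpace.toDual ℝ E3).symm.differentiable.differentiableAt).comp y
      (h1.differentiable (by simp)).differentiableAt
  rw [inner_curl_cross_self hgd, hY.inner_fderiv_gradient_self hl, hY.divergence_gradient, gradient,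
    InnerProductSpace.toDual_symm_apply, hY.fderiv_apply_self]
  ring

/-- Smoothness of the radial factor `y ↦ h(|y|²)`. [folklore] -/
theorem contDiff_radial {h : ℝ → ℝ} {n : WithTop ℕ∞} (hh : ContDiff ℝ n h) :
    ContDiff ℝ n (fun y : E3 => h (‖y‖ ^ 2)) :=
  hh.comp (contDiff_norm_sq ℝ)

/-- The gradient of `y ↦ h(|y|²)` is RADIAL: `∇(h(|y|²)) = 2h′(|y|²) y`. [folklore] -/
theorem gradient_radial {h : ℝ → ℝ} (hh : Differentiable ℝ h) (y : E3) :
    gradient (fun z : E3 => h (‖z‖ ^ 2)) y = (2 * deriv h (‖y‖ ^ 2)) • y := by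
  have hN : HasFDerivAt (fun z : E3 => ‖z‖ ^ 2) (2 • innerSL ℝ y) y := (hasStrictFDerivAt_norm_sq y).hasFDerivAt
  have hH : HasFDerivAt (fun z : E3 => h (‖z‖ ^ 2)) ((2 * deriv h (‖y‖ ^ 2)) • innerSL ℝ y) y := by
    have hc := ((hh (‖y‖ ^ 2)).hasDerivAt).comp_hasFDerivAt y hN
    refine hc.congr_fderiv ?_
    ext v
    simp [two_smul]
    ring
  rw [gradient, hH.fderiv, map_smul, toDual_symm_innerSL]

/-- CURL OF ONE SHELL: `curl (h(|y|²) Y(y) y) = h(|y|²) (∇Y × y)` (the radial gradient drops out: `y × y = 0`). [folklore] -/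
theorem curl_shell_eq {h : ℝ → ℝ} (hh : Differentiable ℝ h) {Y : E3 → ℝ} (hYd : Differentiable ℝ Y) :
    curl (fun z : E3 => (h (‖z‖ ^ 2) * Y z) • z) = fun z : E3 => h (‖z‖ ^ 2) • cross (gradient Y z) z := by
  funext y
  have hHd : DifferentiableAt ℝ (fun z : E3 => h (‖z‖ ^ 2)) y :=
    (hh (‖y‖ ^ 2)).comp y ((contDiff_norm_sq ℝ (n := 1)).differentiable one_ne_zero).differentiableAt
  have hYid : DifferentiableAt ℝ (fun z : E3 => Y z • z) y := (hYd y).smul differentiableAt_id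
  have e : (fun z : E3 => (h (‖z‖ ^ 2) * Y z) • z) = fun z : E3 => h (‖z‖ ^ 2) • (Y z • z) := by
    funext z
    rw [mul_smul]
  have hrad : cross ((2 * deriv h (‖y‖ ^ 2)) • y) (Y y • y) = 0 := by
    ext i
    fin_cases i <;> simp [cross]
  rw [e, curl_smul hHd hYid, curl_smul_self (hYd y), curlCLM_smulRight, ← gradient, gradient_radial hh, hrad, add_zero]

/-- THE RADIAL IDENTITY FOR ONE SHELL: `⟪curl curl (h(|y|²) Y(y) y), y⟫ = l(l+1) h(|y|²) Y(y)` for `h ∈ C¹` and a solid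
harmonic `Y` of degree `l ≥ 1` — the radial velocity of a poloidal shell is `l(l+1)` times its stream function. [folklore] -/
theorem inner_curl_curl_shell_self {h : ℝ → ℝ} (hh : ContDiff ℝ 1 h) {l : ℕ} {Y : E3 → ℝ} (hY : IsSolidHarmonic l Y)
    (hl : 1 ≤ l) (y : E3) :
    inner ℝ (curl (curl (fun z : E3 => (h (‖z‖ ^ 2) * Y z) • z)) y) y =
      ((l : ℝ) * ((l : ℝ) + 1)) * (h (‖y‖ ^ 2) * Y y) := by
  have hhd : Differentiable ℝ h := hh.differentiable (by simp)
  have hYd : Differentiable ℝ Y := hY.contDiff.differentiable (by simp)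
  rw [curl_shell_eq hhd hYd]
  -- differentiability of `V = ∇Y × y` at `y`
  have hC2 : ContDiff ℝ 2 Y := hY.contDiff.of_le (by norm_cast)
  have h1 : ContDiff ℝ 1 (fderiv ℝ Y) := hC2.fderiv_right (m := 1) (by norm_cast)
  have hgd : DifferentiableAt ℝ (gradient Y) y :=
    ((InnerProductSpace.toDual ℝ E3).symm.differentiable.differentiableAt).comp y
      (h1.differentiable (by simp)).differentiableAt
  have hV : DifferentiableAt ℝ (fun z : E3 => cross (gradient Y z) z) y :=
    (hasFDerivAt_cross hgd.hasFDerivAt (hasFDerivAt_id y)).differentiableAt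
  have hHd : DifferentiableAt ℝ (fun z : E3 => h (‖z‖ ^ 2)) y :=
    (hhd (‖y‖ ^ 2)).comp y ((contDiff_norm_sq ℝ (n := 1)).differentiable one_ne_zero).differentiableAt
  have hrad : inner ℝ (cross ((2 * deriv h (‖y‖ ^ 2)) • y) (cross (gradient Y y) y)) y = 0 := by
    simp only [cross, PiLp.inner_apply, RCLike.inner_apply, conj_trivial, Fin.sum_univ_three,
      cross_apply, Matrix.cons_val_zero, Matrix.cons_val_one, Matrix.cons_val_two,
      Matrix.head_cons, Matrix.tail_cons, PiLp.smul_apply, smul_eq_mul]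
    ring
  rw [curl_smul hHd hV, curlCLM_smulRight, ← gradient, gradient_radial hhd, inner_add_left,
    inner_smul_left, hY.inner_curl_cross_gradient_self hl, hrad]
  simp only [conj_trivial, add_zero]
  ring

/-! ## §4 Isotypic sums: `⟪u, y⟫ = l(l+1) ψ` for `u = curl curl(ψ y)`, `ψ = Σ c_m(|y|) B_m(y)` -/

/-- Curl of a translate, as a function: `curl (F(· − a)) = (curl F)(· − a)`. [folklore] -/
theorem curl_comp_sub_const_fun (F : E3 → E3) (a : E3) :
    curl (fun x : E3 => F (x - a)) = fun x : E3 => curl F (x - a) := by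
  funext x
  simp only [curl, fderiv_comp_sub]

/-- Curl of a finite sum of differentiable fields. [folklore] -/
theorem curl_finset_sum {ι : Type*} (s : Finset ι) {f : ι → E3 → E3} {x : E3}
    (h : ∀ i ∈ s, DifferentiableAt ℝ (f i) x) :
    curl (fun y : E3 => ∑ i ∈ s, f i y) x = ∑ i ∈ s, curl (f i) x := by
  rw [curl_eq_curlCLM, fderiv_fun_sum h, map_sum]
  rfl

/-- One shell `(h(|y|²) Y(y)) y` is a smooth field. [folklore] -/
theorem contDiff_shell {h : ℝ → ℝ} (hh : ContDiff ℝ (⊤ : ℕ∞) h) {l : ℕ} {Y : E3 → ℝ} (hY : IsSolidHarmonic l Y) :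
    ContDiff ℝ (⊤ : ℕ∞) (fun z : E3 => (h (‖z‖ ^ 2) * Y z) • z) :=
  ((contDiff_radial hh).mul hY.contDiff).smul contDiff_id

/-- THE RADIAL IDENTITY FOR ISOTYPIC DATA: for an admissible degree-`l` isotypic family (`l ≥ 1`),
`⟪isoShellL n c B x₀ (x₀ + y), y⟫ = l(l+1) Σ_m c_m(|y|) B_m(y)` — the stream function is read off the radial velocity. [folklore] -/
theorem inner_isoShellL_self {l n : ℕ} (hl : 1 ≤ l) {c : Fin n → ℝ → ℝ} {B : Fin n → E3 → ℝ}
    (hadm : IsoAdmissibleL l n c B) (x₀ y : E3) :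
    inner ℝ (isoShellL n c B x₀ (x₀ + y)) y = ((l : ℝ) * ((l : ℝ) + 1)) * ∑ m, c m ‖y‖ * B m y := by
  choose h hh hc using fun m => (hadm.2 m).1
  -- the datum as a translate of a sum of shells
  set f : Fin n → E3 → E3 := fun m z => (h m (‖z‖ ^ 2) * B m z) • z with hf
  have hG : (fun x : E3 => (∑ m, c m ‖x - x₀‖ * B m (x - x₀)) • (x - x₀)) =
      fun x : E3 => (fun z : E3 => ∑ m, f m z) (x - x₀) := by
    funext x
    simp only [hf, Finset.sum_smul]
    refine Finset.sum_congr rfl fun m _ => ?_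
    rw [hc m ‖x - x₀‖ (norm_nonneg _)]
  have hfs : ∀ m, ContDiff ℝ (⊤ : ℕ∞) (f m) := fun m => contDiff_shell (hh m) (hadm.1 m)
  have hfd : ∀ m, Differentiable ℝ (f m) := fun m => (hfs m).differentiable (by simp)
  have hcfd : ∀ m, Differentiable ℝ (curl (f m)) := fun m =>
    (contDiff_curl ((hfs m).of_le (by norm_cast) : ContDiff ℝ (1 + 1) (f m))).differentiable
      (by simp)
  have hcurl1 : curl (fun z : E3 => ∑ m, f m z) = fun z : E3 => ∑ m, curl (f m) z := by
    funext z
    exact curl_finset_sum Finset.univ fun m _ => hfd m z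
  unfold isoShellL
  rw [hG, curl_comp_sub_const_fun (fun z : E3 => ∑ m, f m z) x₀, hcurl1,
    curl_comp_sub_const_fun (fun z : E3 => ∑ m, curl (f m) z) x₀]
  simp only [add_sub_cancel_left]
  rw [curl_finset_sum Finset.univ (fun m _ => hcfd m y), sum_inner, Finset.mul_sum]
  refine Finset.sum_congr rfl fun m _ => ?_
  rw [hf]
  rw [inner_curl_curl_shell_self ((hh m).of_le (by norm_cast)) (hadm.1 m) hl y,
    hc m ‖y‖ (norm_nonneg _)]

end Summit.NavierStokesRegularity.NavierStokesRegularity.Theorems.UnthreadedRigidity.VirialHorn
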